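import Summits.AtomisticToContinuum.Crystallization.Theorems.FrustratedLawDichotomyStrainedPatchHomSplit

/-!
# Linear isometries of `E3` from explicit orthogonal matrices (certificate data for the fit prune)

Critic row 769 (n1) (decomp-a2c hand-1 g19): the (P1) fit prune of the `HomFloor` certificate (`…StrainedPatchHomPrunesFit.
goodAtScale_centre_of_fit_*`) consumes a linear isometry `A : E3 →ₗᵢ[ℝ] E3`; a checker supplies it as an explicit (rational) `3 × 3`
matrix `Q` with `Qᵀ Q = 1` (e.g. the Cayley transform of a rational skew matrix).  This DEF-FREE file turns such a `Q` into the
isometry, with the coordinate formula `(A x) i = Σⱼ Q i j · x j` the checker computes with; `Qᵀ Q = 1` is the ONLY obligation.  `--supports stmt-AtomisticToContinuum-27623`.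
-/

namespace Summit.AtomisticToContinuum.Crystallization.Theorems.FrustratedLawDichotomyStrainedPatchHomOrthogonal

open scoped BigOperators RealInnerProductSpace
open Matrix
open Summit.AtomisticToContinuum.Crystallization.Theorems.ChargedEnergyGapNegative (E3)

/-- Orthogonal matrices preserve the dot product: `(Q x)·(Q y) = x·y` when `Qᵀ Q = 1`. [folklore] -/
theorem dotProduct_mulVec_mulVec_of_orthogonal {n : Type*} [Fintype n] [DecidableEq n] (Q : Matrix n n ℝ) (hQ : Qᵀ * Q = 1)
    (x y : n → ℝ) : (Q *ᵥ x) ⬝ᵥ (Q *ᵥ y) = x ⬝ᵥ y := by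
  rw [dotProduct_mulVec, ← mulVec_transpose, mulVec_mulVec, hQ, one_mulVec]

/-- ★ **An orthogonal matrix IS a linear isometry of `E3`** (coordinate formula included): for `Qᵀ Q = 1` there is
`A : E3 →ₗᵢ[ℝ] E3` with `(A x) i = Σⱼ Q i j · x j`. [folklore] -/
theorem exists_linearIsometry_of_orthogonal (Q : Matrix (Fin 3) (Fin 3) ℝ) (hQ : Qᵀ * Q = 1) :
    ∃ A : E3 →ₗᵢ[ℝ] E3, ∀ (x : E3) (i : Fin 3), A x i = ∑ j, Q i j * x j := by
  let L : E3 →ₗ[ℝ] E3 := Matrix.toEuclideanLin Q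
  have hLapp : ∀ x : E3, L x = WithLp.toLp 2 (Q *ᵥ WithLp.ofLp x) := fun x => rfl
  have hL : ∀ x y : E3, ⟪L x, L y⟫ = ⟪x, y⟫ := fun x y => by
    rw [hLapp, hLapp, EuclideanSpace.inner_eq_star_dotProduct, EuclideanSpace.inner_eq_star_dotProduct]
    simp only [star_trivial]
    exact dotProduct_mulVec_mulVec_of_orthogonal Q hQ _ _
  refine ⟨L.isometryOfInner hL, fun x i => ?_⟩
  rw [LinearMap.coe_isometryOfInner, hLapp]
  rfl

/-- The isometry acts on the standard frame by the columns of `Q`: `A (single k 1) i = Q i k`. [folklore] -/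
theorem exists_linearIsometry_of_orthogonal' (Q : Matrix (Fin 3) (Fin 3) ℝ) (hQ : Qᵀ * Q = 1) :
    ∃ A : E3 →ₗᵢ[ℝ] E3, (∀ (x : E3) (i : Fin 3), A x i = ∑ j, Q i j * x j) ∧
      ∀ x : E3, ‖A x‖ = ‖x‖ := by
  obtain ⟨A, hA⟩ := exists_linearIsometry_of_orthogonal Q hQ
  exact ⟨A, hA, fun x => A.norm_map x⟩

/-- `Q Qᵀ = 1` from `Qᵀ Q = 1` (square matrices), so either orientation of the certificate's check suffices. [folklore] -/
theorem mul_transpose_eq_one_of_transpose_mul_eq_one {n : Type*} [Fintype n] [DecidableEq n] (Q : Matrix n n ℝ)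
    (hQ : Qᵀ * Q = 1) : Q * Qᵀ = 1 :=
  mul_eq_one_comm.mp hQ

end Summit.AtomisticToContinuum.Crystallization.Theorems.FrustratedLawDichotomyStrainedPatchHomOrthogonal
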